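import Summits.AnomalousDissipation.AnomalousDissipation.Theorems.SawtoothPulseCascadeK3NonlinearClosureSlavingAsymptotics
import Summits.AnomalousDissipation.AnomalousDissipation.Theorems.SawtoothPulseCascadeConstructionRegular58
import Literature.Analysis.FunctionSpaces.TorusCalculusProofs
import Literature.Analysis.FunctionSpaces.TorusSpaceTime
import HarnessLib

/-!
# K3′ `K3NonlinearClosure` (aside, stmt-AnomalousDissipation-20027), line `Localised` — LEMMA X:
# planar slaving ⇒ Grenier's `ApproximateSolution` with the TRIVIAL witness `U := V_ν` (defect `ρ = 0`)

For the registered stub S5 of the line `Localised`: if the planar Navier–Stokes solution `V_ν` forced by `∂ₜū` from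
rest is SLAVED to the carrier on the localised window (the line's `PlanarSlaving P r`, here with its body spelled out:
`‖V_ν(t) − ū(t)‖_{L²} ≤ K ν Σ_{i≤j}(N_i/√δ_i) M^{j−i}` on phase `j ≤ J_r(ν) + A`, `M = max(ρN, 3e^{σ⋆γ})`), then
`DriftFree.ApproximateSolution P r` holds with `U := V_ν`, `ρ := 0`, `q := φ`, `Λ :=` a constant strain bound of
`V_ν` on `[0, T_A(ν)]` — provided `Λ⋆ := max(M, ρN√d) < r` (true inside the closure window on the box).  The only
quantitative clause is `∫₀^{T_A(ν)} ‖V_ν − ū‖² ≤ εν`, which is the asymptotics of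
`SawtoothPulseCascadeK3NonlinearClosureSlavingAsymptotics` (`slavingSum_le`, `exists_nu_slavingGrowth_le`).
Consumed by `Theorems.SawtoothPulseCascade.DriftFreeClosure.planarAnomalousFamily_of` (the landed drift-free closure).
No definitions, no named facts.
-/

-- `Summit.<Summit>.<Problem>`: single-conjunct summit, the duplicate namespace segment is deliberate.
set_option linter.dupNamespace false

noncomputable section

namespace Summit.AnomalousDissipation.AnomalousDissipation.Theorems.SawtoothPulseCascade.K3NonlinearClosureLocalised

open MeasureTheory Set Filter Topology
open scoped InnerProductSpace
open Literature.Analysis Literature.Analysis.FunctionSpaces Literature.Analysis.FluidPDE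
open Literature.Analysis.FluidPDE.SawtoothCascade
open Literature.Analysis.FluidPDE.SawtoothCascade.DriftFree

/-! ## Strain bound and `L²`-continuity for classical fields on a closed window -/

/-- A jointly smooth planar field on `[0,1)` has bounded strain on every closed window `[0,T]`, `T < 1`:
`⟪ξ, (ξ·∇)V(t,x)⟫ ≤ Λ₀‖ξ‖²` with `Λ₀ = Σᵢ sup‖∂ᵢV‖` (`(ξ·∇)V = Σᵢ ξᵢ ∂ᵢV`). -/
theorem exists_strainBound_const {V : ℝ → UnitAddTorus (Fin 2) → EuclideanSpace ℝ (Fin 2)}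
    (hV : FunctionSpaces.Torus.IsSmoothSpaceTimeOn (Ico (0 : ℝ) 1) V) {T : ℝ} (hT : T < 1) :
    ∃ Λ₀ : ℝ, 0 ≤ Λ₀ ∧ StrainBoundedBy V (fun _ => Λ₀) (Icc 0 T) := by
  have hU : UniqueDiffOn ℝ (Ico (0 : ℝ) 1) := uniqueDiffOn_Ico 0 1
  have hI : Icc 0 T ⊆ Ico (0 : ℝ) 1 := fun s hs => ⟨hs.1, lt_of_le_of_lt hs.2 hT⟩
  obtain ⟨B0, hB0⟩ := (hV.partialDeriv hU 0).exists_norm_le_of_isCompact isCompact_Icc hI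
  obtain ⟨B1, hB1⟩ := (hV.partialDeriv hU 1).exists_norm_le_of_isCompact isCompact_Icc hI
  have hB0' : 0 ≤ max B0 0 := le_max_right _ _
  have hB1' : 0 ≤ max B1 0 := le_max_right _ _
  refine ⟨max B0 0 + max B1 0, by positivity, fun t ht x ξ => ?_⟩
  have hsm : FunctionSpaces.Torus.IsSmooth (V t) := hV.isSmooth_slice (hI ht)
  have hconv : FunctionSpaces.Torus.convect (fun _ => ξ) (V t) x =
      ∑ i, ξ i • FunctionSpaces.Torus.partialDeriv i (V t) x := by
    rw [FunctionSpaces.Torus.convect, FunctionSpaces.Torus.fderiv_apply_eq_sum_partialDeriv (hsm.isContDiff (by simp))]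
  rw [hconv, Fin.sum_univ_two, inner_add_right, real_inner_smul_right, real_inner_smul_right]
  have hnorm : ‖ξ‖ = Real.sqrt (|ξ 0| ^ 2 + |ξ 1| ^ 2) := by
    rw [EuclideanSpace.norm_eq, Fin.sum_univ_two]; simp only [Real.norm_eq_abs]
  have hξ0 : |ξ 0| ≤ ‖ξ‖ := by
    rw [hnorm]; exact Real.abs_le_sqrt (by rw [sq_abs]; nlinarith [sq_nonneg (ξ 1), sq_abs (ξ 0), sq_abs (ξ 1)])
  have hξ1 : |ξ 1| ≤ ‖ξ‖ := by
    rw [hnorm]; exact Real.abs_le_sqrt (by rw [sq_abs]; nlinarith [sq_nonneg (ξ 0), sq_abs (ξ 0), sq_abs (ξ 1)])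
  have h0 : ξ 0 * ⟪ξ, FunctionSpaces.Torus.partialDeriv 0 (V t) x⟫_ℝ ≤ max B0 0 * ‖ξ‖ ^ 2 := by
    calc ξ 0 * ⟪ξ, FunctionSpaces.Torus.partialDeriv 0 (V t) x⟫_ℝ
        ≤ |ξ 0| * (‖ξ‖ * ‖FunctionSpaces.Torus.partialDeriv 0 (V t) x‖) := by
          have := abs_real_inner_le_norm ξ (FunctionSpaces.Torus.partialDeriv 0 (V t) x)
          calc _ ≤ |ξ 0 * ⟪ξ, FunctionSpaces.Torus.partialDeriv 0 (V t) x⟫_ℝ| := le_abs_self _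
            _ = |ξ 0| * |⟪ξ, FunctionSpaces.Torus.partialDeriv 0 (V t) x⟫_ℝ| := abs_mul _ _
            _ ≤ _ := mul_le_mul_of_nonneg_left this (abs_nonneg _)
      _ ≤ ‖ξ‖ * (‖ξ‖ * max B0 0) := by
          gcongr
          exact (hB0 t ht x).trans (le_max_left _ _)
      _ = max B0 0 * ‖ξ‖ ^ 2 := by ring
  have h1 : ξ 1 * ⟪ξ, FunctionSpaces.Torus.partialDeriv 1 (V t) x⟫_ℝ ≤ max B1 0 * ‖ξ‖ ^ 2 := by
    calc ξ 1 * ⟪ξ, FunctionSpaces.Torus.partialDeriv 1 (V t) x⟫_ℝ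
        ≤ |ξ 1| * (‖ξ‖ * ‖FunctionSpaces.Torus.partialDeriv 1 (V t) x‖) := by
          have := abs_real_inner_le_norm ξ (FunctionSpaces.Torus.partialDeriv 1 (V t) x)
          calc _ ≤ |ξ 1 * ⟪ξ, FunctionSpaces.Torus.partialDeriv 1 (V t) x⟫_ℝ| := le_abs_self _
            _ = |ξ 1| * |⟪ξ, FunctionSpaces.Torus.partialDeriv 1 (V t) x⟫_ℝ| := abs_mul _ _
            _ ≤ _ := mul_le_mul_of_nonneg_left this (abs_nonneg _)
      _ ≤ ‖ξ‖ * (‖ξ‖ * max B1 0) := by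
          gcongr
          exact (hB1 t ht x).trans (le_max_left _ _)
      _ = max B1 0 * ‖ξ‖ ^ 2 := by ring
  calc ξ 0 * ⟪ξ, FunctionSpaces.Torus.partialDeriv 0 (V t) x⟫_ℝ + ξ 1 * ⟪ξ, FunctionSpaces.Torus.partialDeriv 1 (V t) x⟫_ℝ
      ≤ max B0 0 * ‖ξ‖ ^ 2 + max B1 0 * ‖ξ‖ ^ 2 := add_le_add h0 h1
    _ = (max B0 0 + max B1 0) * ‖ξ‖ ^ 2 := by ring

/-- The squared `L²` distance of two fields jointly smooth on `[0,1)` is continuous on every `[0,T]`, `T < 1`. -/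
theorem continuousOn_vectorL2Sq_sub {V W : ℝ → UnitAddTorus (Fin 2) → EuclideanSpace ℝ (Fin 2)}
    (hV : FunctionSpaces.Torus.IsSmoothSpaceTimeOn (Ico (0 : ℝ) 1) V)
    (hW : FunctionSpaces.Torus.IsSmoothSpaceTimeOn (Ico (0 : ℝ) 1) W) {T : ℝ} (hT : T < 1) :
    ContinuousOn (fun s => FluidPDE.Torus.vectorL2Sq (V s - W s)) (Icc 0 T) := by
  have hI : Icc 0 T ⊆ Ico (0 : ℝ) 1 := fun s hs => ⟨hs.1, lt_of_le_of_lt hs.2 hT⟩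
  have hD : FunctionSpaces.Torus.IsSmoothSpaceTimeOn (Ico (0 : ℝ) 1) (fun t x => V t x - W t x) := hV.sub hW
  have hc := (hD.inner hD).continuousOn_integral (convex_Ico 0 1)
  refine (hc.mono hI).congr fun s _ => ?_
  simp only [FluidPDE.Torus.vectorL2Sq]
  refine integral_congr_ae (Eventually.of_forall fun x => ?_)
  simp only [Pi.sub_apply]
  exact (real_inner_self_eq_norm_sq _).symm

/-! ## Planar slaving ⇒ approximate solution (trivial witness) -/

/-- **LEMMA X.** Planar slaving of `V_ν` to `ū` on the localised window (body of the line's `PlanarSlaving P r`),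
the existence package and `max(max(ρN, 3e^{σ⋆γ}), ρN√d) < r` give Grenier's `ApproximateSolution P r` with the
trivial witness `U := V_ν`, `ρ := 0`: `∫₀^{T_A(ν)}‖V_ν − ū‖² ≤ K²ν²(J+A+1)²(N₀/√δ₀)²Λ^{2(J+A)} ≤ εν` for small `ν`
(`slavingSum_le`, `exists_nu_slavingGrowth_le`), the defect clauses being trivial. -/
theorem approximateSolution_of_planarSlaving (P : CascadeParams) (hδ₀ : 0 < P.δ₀) (hd : 0 < P.d)
    (hN₀ : 1 ≤ P.N₀) (hρ : 2 ≤ P.ρN) {r : ℝ} (hr : 1 < r)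
    (hΛr : max (max (P.ρN : ℝ) (3 * Real.exp (sawSigmaStar * P.γ))) ((P.ρN : ℝ) * Real.sqrt P.d) < r)
    (hPS : ∀ A : ℕ, ∃ ν₀ : ℝ, 0 < ν₀ ∧ ∃ K : ℝ, ∀ ν ∈ Ioc 0 ν₀,
      ∀ (V : ℝ → UnitAddTorus (Fin 2) → EuclideanSpace ℝ (Fin 2)) (φ : ℝ → UnitAddTorus (Fin 2) → ℝ),
        FunctionSpaces.Torus.IsClassicalNSSolutionOn (Ico (0 : ℝ) 1) ν (planarForce P) V φ → V 0 = 0 →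
        ∀ j ≤ Jrate r ν + A, ∀ t ∈ Icc (CascadeParams.tStart j) (CascadeParams.tStart (j + 1)),
          Real.sqrt (FluidPDE.Torus.vectorL2Sq (V t - P.field t)) ≤
            K * ν * ∑ i ∈ Finset.range (j + 1),
              (P.N i : ℝ) / Real.sqrt (P.δ i) * (max (P.ρN : ℝ) (3 * Real.exp (sawSigmaStar * P.γ))) ^ (j - i))
    (hEx : Existence P) : ApproximateSolution P r := by
  intro A ε hε
  set M : ℝ := max (P.ρN : ℝ) (3 * Real.exp (sawSigmaStar * P.γ)) with hM
  set Λ : ℝ := max M ((P.ρN : ℝ) * Real.sqrt P.d) with hΛ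
  set c : ℝ := (P.N₀ : ℝ) / Real.sqrt P.δ₀ with hc
  have hM0 : 0 ≤ M := le_trans (Nat.cast_nonneg _) (le_max_left _ _)
  have hρ2 : (2 : ℝ) ≤ P.ρN := by exact_mod_cast hρ
  have hΛ1 : 1 ≤ Λ := le_trans (by linarith) ((le_max_left _ _).trans (le_max_left _ _) : (P.ρN : ℝ) ≤ Λ)
  have hΛ0 : 0 < Λ := lt_of_lt_of_le one_pos hΛ1
  have hc0 : 0 ≤ c := by positivity
  obtain ⟨ν₀, hν₀, K, hK⟩ := hPS A
  -- the asymptotics: `ν (J+A+1)² Λ^{2(J+A)} ≤ ε / (K² c² + 1)` for `ν ≤ ν₁`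
  have hε' : 0 < ε / (K ^ 2 * c ^ 2 + 1) := by positivity
  obtain ⟨ν₁, hν₁, hgrowth⟩ := exists_nu_slavingGrowth_le hr hΛ0 hΛr A hε'
  refine ⟨min ν₀ ν₁, lt_min hν₀ hν₁, fun ν hν => ?_⟩
  have hν0 : 0 < ν := hν.1
  have hνν₀ : ν ∈ Ioc 0 ν₀ := ⟨hν0, hν.2.trans (min_le_left _ _)⟩
  have hνν₁ : ν ∈ Ioc 0 ν₁ := ⟨hν0, hν.2.trans (min_le_right _ _)⟩
  obtain ⟨⟨V, φ, R, hV, hV0, -, -, -⟩, -⟩ := hEx ν hν0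
  set T : ℝ := horizon r ν A with hTdef
  have hT1 : T < 1 := CascadeParams.tStart_lt_one _
  have hT0 : 0 ≤ T := CascadeParams.tStart_nonneg _
  have hfs : CascadeFieldSmooth P := cascadeFieldSmooth P hδ₀ hd
  obtain ⟨Λ₀, -, hstrain⟩ := exists_strainBound_const hV.smooth_velocity hT1
  have hcont : ContinuousOn (fun s => FluidPDE.Torus.vectorL2Sq (V s - P.field s)) (Icc 0 T) :=
    continuousOn_vectorL2Sq_sub hV.smooth_velocity hfs hT1
  -- the pointwise bound on `[0, T]`
  set B : ℝ := K * ν * ((((Jrate r ν + A + 1 : ℕ) : ℝ)) * c * Λ ^ (Jrate r ν + A)) with hB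
  have hpt : ∀ s ∈ Icc 0 T, FluidPDE.Torus.vectorL2Sq (V s - P.field s) ≤ B ^ 2 := by
    intro s hs
    obtain ⟨j, hj, hj'⟩ := Cascade.exists_phase hs.1 (lt_of_le_of_lt hs.2 hT1)
    have hjJ : j ≤ Jrate r ν + A := by
      by_contra hlt
      have hlt' : Jrate r ν + A + 1 ≤ j := by omega
      have h1 : CascadeParams.tStart (Jrate r ν + A + 1) ≤ CascadeParams.tStart j :=
        CascadeParams.tStart_strictMono.monotone hlt'
      have h2 : CascadeParams.tStart (Jrate r ν + A) < CascadeParams.tStart (Jrate r ν + A + 1) :=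
        CascadeParams.tStart_strictMono (Nat.lt_succ_self _)
      have h3 : s ≤ CascadeParams.tStart (Jrate r ν + A) := hs.2
      linarith
    have hsl := hK ν hνν₀ V φ hV hV0 j hjJ s ⟨hj, hj'.le⟩
    have hS : ∑ i ∈ Finset.range (j + 1), (P.N i : ℝ) / Real.sqrt (P.δ i) * M ^ (j - i) ≤
        ((j : ℝ) + 1) * c * Λ ^ j := slavingSum_le P hδ₀ hd hM0 j
    have hS' : ((j : ℝ) + 1) * c * Λ ^ j ≤ (((Jrate r ν + A + 1 : ℕ) : ℝ)) * c * Λ ^ (Jrate r ν + A) := by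
      have hj1 : (j : ℝ) + 1 ≤ ((Jrate r ν + A + 1 : ℕ) : ℝ) := by
        have : (j : ℝ) ≤ ((Jrate r ν + A : ℕ) : ℝ) := by exact_mod_cast hjJ
        push_cast at this ⊢; linarith
      have hpow : Λ ^ j ≤ Λ ^ (Jrate r ν + A) := pow_le_pow_right₀ hΛ1 hjJ
      have hj0 : 0 ≤ (j : ℝ) + 1 := by positivity
      calc ((j : ℝ) + 1) * c * Λ ^ j ≤ (((Jrate r ν + A + 1 : ℕ) : ℝ)) * c * Λ ^ j := by gcongr
        _ ≤ (((Jrate r ν + A + 1 : ℕ) : ℝ)) * c * Λ ^ (Jrate r ν + A) := by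
            apply mul_le_mul_of_nonneg_left hpow; positivity
    -- `K ν S_j ≤ |K| ν S*` would need the sign of `K`; instead square directly from `0 ≤ √· ≤ K ν S_j`
    have hsum0 : 0 ≤ ∑ i ∈ Finset.range (j + 1), (P.N i : ℝ) / Real.sqrt (P.δ i) * M ^ (j - i) :=
      Finset.sum_nonneg fun i _ => by positivity
    have hKνS : Real.sqrt (FluidPDE.Torus.vectorL2Sq (V s - P.field s)) ≤ |K| * ν * ((((Jrate r ν + A + 1 : ℕ) : ℝ)) * c * Λ ^ (Jrate r ν + A)) := by
      calc Real.sqrt (FluidPDE.Torus.vectorL2Sq (V s - P.field s))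
          ≤ K * ν * ∑ i ∈ Finset.range (j + 1), (P.N i : ℝ) / Real.sqrt (P.δ i) * M ^ (j - i) := hsl
        _ ≤ |K| * ν * ∑ i ∈ Finset.range (j + 1), (P.N i : ℝ) / Real.sqrt (P.δ i) * M ^ (j - i) := by
            gcongr; exact le_abs_self K
        _ ≤ |K| * ν * ((((Jrate r ν + A + 1 : ℕ) : ℝ)) * c * Λ ^ (Jrate r ν + A)) := by
            apply mul_le_mul_of_nonneg_left (hS.trans hS'); positivity
    have hsq : FluidPDE.Torus.vectorL2Sq (V s - P.field s) =
        Real.sqrt (FluidPDE.Torus.vectorL2Sq (V s - P.field s)) ^ 2 := by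
      rw [Real.sq_sqrt]
      exact integral_nonneg fun x => sq_nonneg _
    rw [hsq]
    have hB' : (|K| * ν * ((((Jrate r ν + A + 1 : ℕ) : ℝ)) * c * Λ ^ (Jrate r ν + A))) ^ 2 = B ^ 2 := by
      rw [hB]; simp [mul_pow, sq_abs]
    rw [← hB']
    exact pow_le_pow_left₀ (Real.sqrt_nonneg _) hKνS 2
  -- integrate over `[0, T] ⊆ [0, 1]`
  have hint : (∫ s in (0 : ℝ)..T, FluidPDE.Torus.vectorL2Sq (V s - P.field s)) ≤ B ^ 2 := by
    have h1 : (∫ s in (0 : ℝ)..T, FluidPDE.Torus.vectorL2Sq (V s - P.field s)) ≤ ∫ _ in (0 : ℝ)..T, B ^ 2 :=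
      intervalIntegral.integral_mono_on hT0 (hcont.intervalIntegrable_of_Icc hT0)
        intervalIntegrable_const fun s hs => hpt s hs
    rw [intervalIntegral.integral_const, smul_eq_mul] at h1
    have h2 : (T - 0) * B ^ 2 ≤ B ^ 2 := by nlinarith [sq_nonneg B]
    exact h1.trans h2
  have hB2 : B ^ 2 ≤ ε * ν := by
    have hg := hgrowth ν hνν₁
    have e : B ^ 2 = K ^ 2 * c ^ 2 * ν *
        (ν * ((((Jrate r ν + A + 1 : ℕ) : ℝ)) ^ 2 * Λ ^ (2 * (Jrate r ν + A)))) := by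
      rw [hB]; ring
    rw [e]
    have hKc : 0 ≤ K ^ 2 * c ^ 2 := by positivity
    calc K ^ 2 * c ^ 2 * ν * (ν * ((((Jrate r ν + A + 1 : ℕ) : ℝ)) ^ 2 * Λ ^ (2 * (Jrate r ν + A))))
        ≤ K ^ 2 * c ^ 2 * ν * (ε / (K ^ 2 * c ^ 2 + 1)) := by
          apply mul_le_mul_of_nonneg_left hg; positivity
      _ = (K ^ 2 * c ^ 2 / (K ^ 2 * c ^ 2 + 1)) * ε * ν := by ring
      _ ≤ 1 * ε * ν := by
          gcongr
          rw [div_le_one (by positivity)]; linarith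
      _ = ε * ν := by ring
  -- the witness `U := V`, `ρ := 0`, `q := φ`, `Λ := Λ₀`
  refine ⟨V, 0, φ, fun _ => Λ₀, ?_, hV0, hstrain, continuousOn_const, ?_, hcont, hint.trans hB2, ?_⟩
  · simpa only [add_zero] using hV
  · simp only [Pi.zero_apply]
    exact continuousOn_const
  · intro t _
    have hz : duhamelDefect (fun _ => Λ₀) 0 t = 0 := by
      simp [duhamelDefect, FluidPDE.Torus.vectorL2Sq]
    rw [hz]
    simp only [ne_eq, OfNat.ofNat_ne_zero, not_false_eq_true, zero_pow]
    positivity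

end Summit.AnomalousDissipation.AnomalousDissipation.Theorems.SawtoothPulseCascade.K3NonlinearClosureLocalised

end
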